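import Mathlib.InformationTheory.Hamming
import Mathlib.LinearAlgebra.FiniteDimensional.Lemmas
import Mathlib.LinearAlgebra.Pi
import HarnessLib

/-!
# Cell qa-qnc0 (rung F-Q1, route RingFrame, crux α, line `tensor`): a linear code has a word of
# weight at least its dimension (the trivial anticode bound; for qn-p2's `DIM₁`, additive case)

Conventions of `Literature/InformationTheory/Coding/GriesmerBound.lean` (a linear code is a
`Submodule F (ι → F)`, weights are Mathlib's `hammingNorm`).  Everything PROVED; no definitions,
no named facts.  (Filed in the cell topic because the statement, though folklore, has no printed
locator at hand; move to `Literature/InformationTheory/Coding/` with a cite if one is found.)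

* `exists_mem_finrank_le_hammingNorm`: every linear code `C ≤ F^ι` (any field `F`, finite `ι`)
  contains a codeword `c` with `dim C ≤ wt(c)`;
* `finrank_le_of_forall_hammingNorm_le`: hence a linear code all of whose words have weight `≤ w`
  has dimension `≤ w` (a linear ANTICODE of diameter `w` — all pairwise distances `≤ w` — has
  dimension `≤ w`).

Proof (restriction to a maximal support, qn-p2 ROUND-3 addendum §C made field-independent): let
`c ∈ C` have maximal weight and `S = supp c`; if `u ∈ C ∖ 0` vanished on `S` then
`supp(c + u) = S ⊔ supp u ⊋ S`, contradicting maximality; so the restriction `C → F^S` is injective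
and `dim C ≤ |S| = wt(c)`.  (Equivalently: the rows of a systematic generator matrix sum to a word
of weight `≥ k`.)  Use (planner qa-qnc0-p2 ROUND-3 addendum §C): the additive case of `DIM₁` — a
strictly light ADDITIVE system of coset leaders `{a_x}` spans a binary linear code all of whose
words have weight `≤ w`, hence of dimension `≤ w`.

HONEST FRAMING: folklore (the first step of every anticode / Erdős–Ko–Rado-type argument for linear
codes); typed because the cell needs it by name.  WHAT THIS IS NOT: nothing on `DIM₁` / `UB` /
STRICT-U beyond the additive case; no separation claim.
-/

namespace Summit.QuantumAdvantage.AdviceFreeQNC0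

open Module Finset

variable {F : Type*} [Field F] [DecidableEq F]
variable {ι : Type*} [Fintype ι] [DecidableEq ι]

omit [DecidableEq ι] in
/-- The weight of a vector is at most the number of coordinates (helper). [folklore] -/
private theorem hammingNorm_le_card (x : ι → F) : hammingNorm x ≤ Fintype.card ι := by
  unfold hammingNorm
  exact (card_le_univ _)

/-- **Every linear code contains a codeword of weight at least its dimension.** [folklore] -/
theorem exists_mem_finrank_le_hammingNorm (C : Submodule F (ι → F)) :
    ∃ c ∈ C, finrank F C ≤ hammingNorm c := by
  classical
  -- a codeword of maximal weight
  set P : ℕ → Prop := fun k => ∃ c ∈ C, hammingNorm c = k with hP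
  set m := Nat.findGreatest P (Fintype.card ι) with hm
  have hP0 : P 0 := ⟨0, C.zero_mem, by simp⟩
  have hPm : P m := by
    rw [hm]
    exact Nat.findGreatest_spec (Nat.zero_le _) hP0
  obtain ⟨c, hcC, hcm⟩ := hPm
  have hmax : ∀ c' ∈ C, hammingNorm c' ≤ m := by
    intro c' hc'
    by_contra hlt
    push Not at hlt
    have hk : ¬ P (hammingNorm c') :=
      Nat.findGreatest_is_greatest hlt (hammingNorm_le_card c')
    exact hk ⟨c', hc', rfl⟩
  refine ⟨c, hcC, ?_⟩
  -- restriction to the support of `c`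
  set S : Finset ι := univ.filter fun i => c i ≠ 0 with hS
  have hSc : S.card = hammingNorm c := by
    unfold hammingNorm; rfl
  let ρ : C →ₗ[F] (S → F) :=
    { toFun := fun u => fun i => (u : ι → F) i
      map_add' := by intro u v; rfl
      map_smul' := by intro a u; rfl }
  -- `ρ` is injective: a nonzero codeword vanishing on `supp c` would enlarge the support of `c`
  have hρ : Function.Injective ρ := by
    rw [← LinearMap.ker_eq_bot, LinearMap.ker_eq_bot']
    intro u hu
    by_contra hne
    have hu0 : ∀ i ∈ S, (u : ι → F) i = 0 := fun i hi => congrFun hu ⟨i, hi⟩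
    have hune : (u : ι → F) ≠ 0 := fun h => hne (Subtype.ext h)
    obtain ⟨j, hj⟩ : ∃ j, (u : ι → F) j ≠ 0 := Function.ne_iff.1 hune
    have hjS : j ∉ S := fun h => hj (hu0 j h)
    have hcj : c j = 0 := by
      by_contra h
      exact hjS (mem_filter.2 ⟨mem_univ _, h⟩)
    -- the support of `c + u` strictly contains `S`
    have hsub : insert j S ⊆ univ.filter fun i => (c + (u : ι → F)) i ≠ 0 := by
      intro i hi
      rw [mem_insert] at hi
      rw [mem_filter]
      refine ⟨mem_univ _, ?_⟩
      rcases hi with rfl | hi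
      · rw [Pi.add_apply, hcj, zero_add]; exact hj
      · rw [Pi.add_apply, hu0 i hi, add_zero]; exact (mem_filter.1 hi).2
    have hgt : m < hammingNorm (c + (u : ι → F)) := by
      calc m = S.card := by rw [hSc, hcm]
        _ < (insert j S).card := by rw [card_insert_of_notMem hjS]; exact Nat.lt_succ_self _
        _ ≤ (univ.filter fun i => (c + (u : ι → F)) i ≠ 0).card := card_le_card hsub
        _ = hammingNorm (c + (u : ι → F)) := by unfold hammingNorm; rfl
    have hle := hmax (c + (u : ι → F)) (C.add_mem hcC u.2)
    omega
  calc finrank F C ≤ finrank F (S → F) := LinearMap.finrank_le_finrank_of_injective hρ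
    _ = Fintype.card S := finrank_fintype_fun_eq_card F
    _ = S.card := Fintype.card_coe S
    _ = hammingNorm c := hSc

/-- **The trivial anticode bound**: a linear code all of whose words have weight `≤ w` has
dimension `≤ w`. [folklore] -/
theorem finrank_le_of_forall_hammingNorm_le (C : Submodule F (ι → F)) {w : ℕ}
    (h : ∀ c ∈ C, hammingNorm c ≤ w) : finrank F C ≤ w := by
  obtain ⟨c, hc, hle⟩ := exists_mem_finrank_le_hammingNorm C
  exact hle.trans (h c hc)

end Summit.QuantumAdvantage.AdviceFreeQNC0
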